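import Summits.FinalStateConjecture.FinalStateConjecture.Theorems.SwallowTheDatumParametricKerrBurialStubTransportPatchB
import Literature.Geometry.Lorentzian.ModelData
import Literature.Geometry.Lorentzian.InitialDataPullback
import Literature.Geometry.Lorentzian.AFEndRestrict
import Literature.Geometry.Manifold.OpenSubmanifoldMFDeriv
import HarnessLib

/-!
# Crux `SwallowTheDatum.UniversalWitnessFamily` (stmt-FinalStateConjecture-10051), line `Sketch`
# (throat-settles-too), stub `stub_socketTransportPatch`

The registered transport-and-patch stub of skeleton v5 (`Cruxes/UniversalWitnessFamily/Lines/Sketch.lean`),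
proved.  Given the receding far-gluing family `G R` (exact isotropic Schwarzschild(`m R`) beyond chart
radius `32R` along the sole end `e`, jointly smooth in `(R, x)`, `m R ≥ ηR`) and the dilated SOCKET BAG
family `Cfam l` on `ℝ³` (vacuum outside the ball of radius `l`, isotropic Schwarzschild(`lμ`), `k = 0`,
on the socket annulus `{l < ‖y‖ < 2l}`, EXACTLY `((1 + lM/2‖y‖)⁴ δ, 0)` on the open exterior sheet
`{‖y‖ > lM/2}`, `M > 4`; jointly smooth in `(l, y)`), set `l(R) = m R/μ ≥ 32R` and

  `P R := G R` inside / `coord^*(Cfam (l R))` beyond chart radius `5l(R)/4`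

(`AFEnd.annulusPatch`, `AFEndAnnulusPatch.lean`).  Joint smoothness, admissibility
(`annulusPatch_mem_admissibleVacuumData_of_vacuumOn` with the end of the bag read off its exact
isotropic far region, `exists_end_of_isIsotropicBeyond`) and agreement off `e.far (32R)` are the
proof of the template `stub_transportPatchB`
(`SwallowTheDatumParametricKerrBurialStubTransportPatchB.lean`) verbatim.  The one new piece is the
SHEET SHIELD `isSheetShielded_of_far_pullback`: the open exterior sheet
`Schwarzschild.isotropicExterior (lM) = {‖y‖ > lM/2}` (`lM/2 > 2l > 5l/4`, so it lies in the zone where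
`P R = coord^* Cfam`) embeds into `X` by `Φ := Φₑ ∘ incl` (`Φₑ = e.dataChartExt` the total inverse
chart of the end, `AFEndChartEmbedding.lean`), with injective differentials (`dcoord ∘ dΦₑ = id`,
`d incl = id`), co-compact far zones (`Φ '' {‖y‖ > R'} ⊇ e.far R'`, compact complement for the sole
end, `IsSoleEnd.isCompact_compl_far`) and `Φ^* (P R) = Schwarzschild.timeSymmetricExteriorData (lM)`
EXACTLY (`(Φₑ^* coord^* C) z = C z`, `pullbackBilin_dataChartExt_apply_of_eq`, and `C` is
`((1 + lM/2‖z‖)⁴ δ, 0)` there).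

References: the route file `Theses/SwallowTheDatum.lean` (item 10051); Corvino 2000, §4; Bartnik 1986,
§1; O'Neill 1983, Ch. 3, p. 58; Misner–Thorne–Wheeler 1973, (31.22); Schoen–Yau 1979, §1.
-/

-- the doubled `FinalStateConjecture` path component is the summit/problem naming scheme, not a mistake
set_option linter.dupNamespace false

noncomputable section

namespace Summit.FinalStateConjecture.FinalStateConjecture.Theorems.SwallowTheDatum.UniversalWitnessFamily

open scoped Manifold ContDiff Topology
open Bundle Set Filter Function Metric Literature.Geometry.Lorentzian Literature.Geometry.Manifold
open Summit.FinalStateConjecture.FinalStateConjecture.Theorems.SwallowTheDatum.ParametricKerrBurial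

variable {X : Type} [TopologicalSpace X] [ChartedSpace E3 X] [IsManifold (𝓡 3) ∞ X]

/-! ## §1 The exterior sheet of a datum on `ℝ³`, read through the chart of the sole end -/

/-- **A datum which beyond chart radius `R₁` is the `coord`-pullback of a datum `C` on `ℝ³` that is
EXACTLY isotropic Schwarzschild(`Mₛ`), `k = 0`, on the open exterior sheet `{‖y‖ > Mₛ/2}`,
`Mₛ/2 ≥ R₁`, is sheet-shielded** (`e` the sole end): the chart is `Φ = Φₑ ∘ incl` of the sheet,
an open embedding with injective differentials (`dcoord ∘ dΦₑ = id`); its far zones `Φ '' {‖y‖ > R'}`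
contain `e.far R'`, whose complement is compact; and `Φ^* D = ((1 + Mₛ/2‖y‖)⁴ δ, 0)` since
`(Φₑ^* coord^* F) z = F z` beyond the chart radius (`AFEndChartEmbedding.lean`). O'Neill 1983, Ch. 3,
p. 58; Bartnik 1986, §1; Misner–Thorne–Wheeler 1973, (31.22). [folklore] -/
theorem isSheetShielded_of_far_pullback (e : AFEnd X) (he : e.IsSoleEnd) (D : InitialDataSet (𝓡 3) X)
    (C : InitialDataSet (𝓡 3) E3) {R₁ Mₛ : ℝ} (hR₁ : e.R ≤ R₁) (hρ : R₁ ≤ Mₛ / 2) (hMₛ : 0 < Mₛ)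
    (hDh : ∀ x ∈ e.far R₁, D.h.inner x = AFEnd.outerField e C.coordH x)
    (hDk : ∀ x ∈ e.far R₁, D.k x = AFEnd.outerField e C.coordK x)
    (hC : IsIsotropicBeyond Mₛ (Mₛ / 2) C) :
    ∃ (M' : ℝ) (hM' : 0 < M') (Φ : Schwarzschild.isotropicExterior M' → X)
      (hΦ : ContMDiff (𝓡 3) (𝓡 3) (∞ + 1) Φ) (hΦ' : ∀ u, Function.Injective (mfderiv (𝓡 3) (𝓡 3) Φ u)),
      Topology.IsOpenEmbedding Φ ∧
      (∀ R' : ℝ, M' / 2 ≤ R' →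
        IsCompact (Φ '' {y : Schwarzschild.isotropicExterior M' | R' < ‖(y : E3)‖})ᶜ) ∧
      D.comap Φ hΦ hΦ' = Schwarzschild.timeSymmetricExteriorData M' hM'.le := by
  -- the points of the sheet lie beyond the chart radius and are sent into `far R₁`
  have hR : ∀ z : Schwarzschild.isotropicExterior Mₛ, e.R < ‖(z : E3)‖ := fun z ↦
    lt_of_le_of_lt (hR₁.trans hρ) (Schwarzschild.mem_isotropicExterior.1 z.2)
  have hfar : ∀ z : Schwarzschild.isotropicExterior Mₛ, e.dataChartExt (z : E3) ∈ e.far R₁ := fun z ↦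
    (e.dataChartExt_mem_far_iff (hR z)).2 (lt_of_le_of_lt hρ (Schwarzschild.mem_isotropicExterior.1 z.2))
  -- the differential of the composed chart `Φₑ ∘ incl` is that of `Φₑ` (`d incl = id`)
  have hmf : ∀ u : Schwarzschild.isotropicExterior Mₛ,
      mfderiv (𝓡 3) (𝓡 3) (e.dataChartExt ∘ (Subtype.val : Schwarzschild.isotropicExterior Mₛ → E3)) u =
        mfderiv 𝓘(ℝ, E3) (𝓡 3) e.dataChartExt (u : E3) := by
    intro u
    have hg : MDifferentiableAt 𝓘(ℝ, E3) (𝓡 3) e.dataChartExt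
        ((Subtype.val : Schwarzschild.isotropicExterior Mₛ → E3) u) :=
      (e.contMDiffAt_dataChartExt (hR u)).mdifferentiableAt (by simp)
    have hf : MDifferentiableAt (𝓡 3) 𝓘(ℝ, E3) (Subtype.val : Schwarzschild.isotropicExterior Mₛ → E3) u :=
      OpenSubmanifold.mdifferentiableAt_subtype_val u
    rw [mfderiv_comp u hg hf, OpenSubmanifold.mfderiv_subtype_val]
    exact ContinuousLinearMap.comp_id _
  have hΦ : ContMDiff (𝓡 3) (𝓡 3) (∞ + 1)
      (e.dataChartExt ∘ (Subtype.val : Schwarzschild.isotropicExterior Mₛ → E3)) := fun u ↦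
    (e.contMDiffAt_dataChartExt (hR u)).comp u contMDiff_subtype_val.contMDiffAt
  have hΦ' : ∀ u, Function.Injective
      (mfderiv (𝓡 3) (𝓡 3) (e.dataChartExt ∘ (Subtype.val : Schwarzschild.isotropicExterior Mₛ → E3)) u) := by
    intro u v w hvw
    rw [hmf u] at hvw
    have h := congrArg (mfderiv (𝓡 3) 𝓘(ℝ, E3) e.coord (e.dataChartExt (u : E3))) hvw
    exact ((e.mfderiv_coord_mfderiv_dataChartExt (hR u) v).symm.trans h).trans
      (e.mfderiv_coord_mfderiv_dataChartExt (hR u) w)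
  have hemb : Topology.IsOpenEmbedding
      (e.dataChartExt ∘ (Subtype.val : Schwarzschild.isotropicExterior Mₛ → E3)) :=
    e.isOpenEmbedding_dataChartExt_comp (Schwarzschild.isotropicExterior Mₛ).2.isOpenEmbedding_subtypeVal hR
  refine ⟨Mₛ, hMₛ, e.dataChartExt ∘ Subtype.val, hΦ, hΦ', hemb, fun R' hR' ↦ ?_, ?_⟩
  · -- co-compact far zones: the complement is closed and contained in `(e.far R')ᶜ`
    have hopen : IsOpen ((e.dataChartExt ∘ (Subtype.val : Schwarzschild.isotropicExterior Mₛ → E3)) ''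
        {y : Schwarzschild.isotropicExterior Mₛ | R' < ‖(y : E3)‖}) :=
      hemb.isOpenMap _ (isOpen_lt continuous_const continuous_subtype_val.norm)
    refine (he.isCompact_compl_far R').of_isClosed_subset hopen.isClosed_compl
      (Set.compl_subset_compl.2 fun x hx ↦ ?_)
    obtain ⟨hxU, hlt⟩ := e.mem_far_iff_coord.1 hx
    exact ⟨⟨e.coord x, Schwarzschild.mem_isotropicExterior.2 (lt_of_le_of_lt hR' hlt)⟩, hlt,
      e.dataChartExt_coord_of_mem hxU⟩
  · -- `Φ^* D = ((1 + Mₛ/2‖y‖)⁴ δ, 0)` on the sheet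
    refine InitialDataSet.ext' (fun u v w ↦ ?_) (fun u v w ↦ ?_)
    · -- `h`: `(Φₑ^* h_D) z = h_C z = (1 + Mₛ/2‖z‖)⁴ δ`
      have h2 : D.h.inner (e.dataChartExt (u : E3)) (mfderiv 𝓘(ℝ, E3) (𝓡 3) e.dataChartExt (u : E3) v)
          (mfderiv 𝓘(ℝ, E3) (𝓡 3) e.dataChartExt (u : E3) w) = C.h.inner (u : E3) v w :=
        DFunLike.congr_fun (DFunLike.congr_fun
          (e.pullbackBilin_dataChartExt_apply_of_eq (hR u) (hDh _ (hfar u))) v) w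
      rw [(hC _ (Schwarzschild.mem_isotropicExterior.1 u.2)).1] at h2
      rw [InitialDataSet.comap_h_inner, hmf u, Schwarzschild.timeSymmetricExteriorData_h_inner]
      exact h2
    · -- `k`: `(Φₑ^* k_D) z = k_C z = 0`
      have h2 : D.k (e.dataChartExt (u : E3)) (mfderiv 𝓘(ℝ, E3) (𝓡 3) e.dataChartExt (u : E3) v)
          (mfderiv 𝓘(ℝ, E3) (𝓡 3) e.dataChartExt (u : E3) w) = C.k (u : E3) v w :=
        DFunLike.congr_fun (DFunLike.congr_fun
          (e.pullbackBilin_dataChartExt_apply_of_eq (hR u) (hDk _ (hfar u))) v) w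
      rw [(hC _ (Schwarzschild.mem_isotropicExterior.1 u.2)).2] at h2
      rw [InitialDataSet.comap_k, hmf u]
      exact h2

/-! ## §2 The stub -/

/-- **Stub `stub_socketTransportPatch`** (registered signature, line `Sketch`, crux item
stmt-FinalStateConjecture-10051): patch the receding far-gluing family with the dilated socket bag
family across the isotropic Schwarzschild annulus, `l(R) = m R/μ`; the member is admissible (vacuum
by locality, the end is the transplanted exact isotropic end of the bag), SHEET-SHIELDED through the
chart of the sole end (`isSheetShielded_of_far_pullback` with `Mₛ = l(R) M`, `R₁ = 5 l(R)/4 ≤ l(R) M/2`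
as `M > 4`), equal to `G R` off `e.far (32R)`, and jointly smooth in `(R, x)`. Corvino 2000, §4;
Bartnik 1986, §1. [folklore] -/
theorem stub_socketTransportPatch :
  ∀ (X : Type) [TopologicalSpace X] [ChartedSpace E3 X] [IsManifold (𝓡 3) ∞ X] [T2Space X]
    [SecondCountableTopology X] [ConnectedSpace X] (e : AFEnd X) (Rstar η μ M : ℝ) (m : ℝ → ℝ)
    (G : ℝ → InitialDataSet (𝓡 3) X) (Cfam : ℝ → InitialDataSet (𝓡 3) E3),
    e.IsSoleEnd → e.R < Rstar → 0 < μ → 32 * μ ≤ η → 4 < M → ContDiff ℝ ∞ m →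
    SmoothSectionsOn 𝓘(ℝ, ℝ) G {p : ℝ × X | Rstar < p.1} →
    (∀ R : ℝ, Rstar < R → G R ∈ admissibleVacuumData X ∧ η * R ≤ m R ∧
      IsExactSchwarzschildBeyond e (G R) (m R) (32 * R)) →
    SmoothSectionsOn 𝓘(ℝ, ℝ) Cfam {p : ℝ × E3 | 0 < p.1} →
    (∀ l : ℝ, 0 < l →
      VacuumOn {y : E3 | l < ‖y‖} (Cfam l) ∧
      (∀ y : E3, l < ‖y‖ → ‖y‖ < 2 * l →
        (Cfam l).h.inner y = (1 + l * μ / (2 * ‖y‖)) ^ 4 • (innerSL ℝ : E3 →L[ℝ] E3 →L[ℝ] ℝ) ∧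
          (Cfam l).k y = 0) ∧
      IsIsotropicBeyond (l * M) (l * M / 2) (Cfam l)) →
    ∃ P : ℝ → InitialDataSet (𝓡 3) X, SmoothSectionsOn 𝓘(ℝ, ℝ) P {p : ℝ × X | Rstar < p.1} ∧
      ∀ R : ℝ, Rstar < R → P R ∈ admissibleVacuumData X ∧
        (∃ (M' : ℝ) (hM' : 0 < M') (Φ : Schwarzschild.isotropicExterior M' → X)
          (hΦ : ContMDiff (𝓡 3) (𝓡 3) (∞ + 1) Φ) (hΦ' : ∀ u, Function.Injective (mfderiv (𝓡 3) (𝓡 3) Φ u)),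
          Topology.IsOpenEmbedding Φ ∧
          (∀ R' : ℝ, M' / 2 ≤ R' →
            IsCompact (Φ '' {y : Schwarzschild.isotropicExterior M' | R' < ‖(y : E3)‖})ᶜ) ∧
          (P R).comap Φ hΦ hΦ' = Schwarzschild.timeSymmetricExteriorData M' hM'.le) ∧
        ∀ x ∉ e.far (32 * R), AgreeAt (P R) (G R) x := by
  intro X _ _ _ _ _ _ e Rstar η μ M m G Cfam he heR hμ h32 hM4 hm hGs hG hCs hC
  classical
  -- the socket scale `l(R) = m R / μ ≥ 32 R`
  let l : ℝ → ℝ := fun R ↦ m R / μ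
  have hlμ : ∀ R, l R * μ = m R := fun R ↦ div_mul_cancel₀ (m R) hμ.ne'
  have hl32 : ∀ {R : ℝ}, Rstar < R → 32 * R ≤ l R := by
    intro R hR
    have h1 := (hG R hR).2.1
    rw [le_div_iff₀ hμ]
    nlinarith [e.R_pos]
  have hRpos : ∀ {R : ℝ}, Rstar < R → 0 < R := fun hR ↦ by linarith [e.R_pos]
  have hlpos : ∀ {R : ℝ}, Rstar < R → 0 < l R := fun hR ↦ by linarith [hl32 hR, hRpos hR]
  have hlcont : Continuous l := (hm.continuous).div_const μ
  have hM0 : 0 < M := by linarith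
  -- the annulus patch data at each radius
  have hA : ∀ {R : ℝ}, Rstar < R → AFEnd.AnnulusPatchData e (G R) (Cfam (l R)) (32 * R) (l R) (m R) := by
    intro R hR
    refine ⟨by linarith [hRpos hR], hl32 hR, hlpos hR, (hG R hR).2.2, fun y h1 h2 ↦ ?_⟩
    have h := ((hC (l R) (hlpos hR)).2.1 y h1 h2)
    rwa [hlμ R] at h
  -- the family
  let P : ℝ → InitialDataSet (𝓡 3) X := fun R ↦
    if h : Rstar < R then AFEnd.annulusPatch (hA h) else G R
  have hP : ∀ {R : ℝ} (h : Rstar < R), P R = AFEnd.annulusPatch (hA h) := fun h ↦ dif_pos h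
  -- pointwise values of the sections of `P`
  have hPfar : ∀ {R : ℝ} (h : Rstar < R) {x : X}, x ∈ e.far (5 / 4 * l R) →
      (P R).h.inner x = AFEnd.outerField e ((Cfam (l R)).coordH) x ∧
        (P R).k x = AFEnd.outerField e ((Cfam (l R)).coordK) x := by
    intro R h x hx
    rw [hP h]
    exact AFEnd.annulusPatch_eq_of_mem_far (hA h) hx
  have hPin : ∀ {R : ℝ} (h : Rstar < R) {x : X}, x ∉ e.closedFar (7 / 4 * l R) →
      (P R).h.inner x = (G R).h.inner x ∧ (P R).k x = (G R).k x := by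
    intro R h x hx
    rw [hP h]
    exact ⟨AFEnd.patch_h_inner_of_not_mem_closedFar (AFEnd.annulusPatchData (hA h)) hx,
      AFEnd.patch_k_of_not_mem_closedFar (AFEnd.annulusPatchData (hA h)) hx⟩
  refine ⟨P, ?_, fun R hR ↦ ⟨?_, ?_, fun x hx ↦ ?_⟩⟩
  · /- joint smoothness on `{R⋆ < R}`: near `(R, x)` with `x` inside, `P = G` on a product
      neighbourhood; with `x` far out, `P` is the outer family. -/
    -- the bag family as a smooth matrix-valued function of `(l, z)`
    have hopenE : IsOpen {p : ℝ × E3 | 0 < p.1} := isOpen_lt continuous_const continuous_fst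
    have hCh : ContMDiffOn (𝓘(ℝ, ℝ).prod 𝓘(ℝ, E3)) 𝓘(ℝ, E3 →L[ℝ] E3 →L[ℝ] ℝ) ∞
        (fun p : ℝ × E3 ↦ (Cfam p.1).coordH p.2) {p : ℝ × E3 | 0 < p.1} :=
      ((contMDiffOn_bilinSection_model_iff (IQ := 𝓘(ℝ, ℝ).prod 𝓘(ℝ, E3)) (b := fun p : ℝ × E3 ↦ p.2)
        (s := fun p : ℝ × E3 ↦ (Cfam p.1).coordH p.2) hopenE).1 hCs.1).2
    have hCk : ContMDiffOn (𝓘(ℝ, ℝ).prod 𝓘(ℝ, E3)) 𝓘(ℝ, E3 →L[ℝ] E3 →L[ℝ] ℝ) ∞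
        (fun p : ℝ × E3 ↦ (Cfam p.1).coordK p.2) {p : ℝ × E3 | 0 < p.1} :=
      ((contMDiffOn_bilinSection_model_iff (IQ := 𝓘(ℝ, ℝ).prod 𝓘(ℝ, E3)) (b := fun p : ℝ × E3 ↦ p.2)
        (s := fun p : ℝ × E3 ↦ (Cfam p.1).coordK p.2) hopenE).1 hCs.2).2
    have hopen : IsOpen {p : ℝ × X | Rstar < p.1} := isOpen_lt continuous_const continuous_fst
    -- generic argument for one of the two sections
    have key : ∀ (secP secG : Π q : ℝ × X, TangentSpace (𝓡 3) q.2 →L[ℝ] TangentSpace (𝓡 3) q.2 →L[ℝ] ℝ)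
        (fld : InitialDataSet (𝓡 3) E3 → E3 → E3 →L[ℝ] E3 →L[ℝ] ℝ),
        ContMDiffOn (𝓘(ℝ, ℝ).prod (𝓡 3)) ((𝓡 3).prod 𝓘(ℝ, E3 →L[ℝ] E3 →L[ℝ] ℝ)) ∞
          (fun q : ℝ × X ↦ TotalSpace.mk' (E3 →L[ℝ] E3 →L[ℝ] ℝ)
            (E := fun x : X ↦ TangentSpace (𝓡 3) x →L[ℝ] TangentSpace (𝓡 3) x →L[ℝ] ℝ) q.2 (secG q))
          {p : ℝ × X | Rstar < p.1} →
        ContMDiffOn (𝓘(ℝ, ℝ).prod 𝓘(ℝ, E3)) 𝓘(ℝ, E3 →L[ℝ] E3 →L[ℝ] ℝ) ∞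
          (fun p : ℝ × E3 ↦ fld (Cfam p.1) p.2) {p : ℝ × E3 | 0 < p.1} →
        (∀ q : ℝ × X, Rstar < q.1 → q.2 ∈ e.far (5 / 4 * l q.1) →
          secP q = AFEnd.outerField e (fld (Cfam (l q.1))) q.2) →
        (∀ q : ℝ × X, Rstar < q.1 → q.2 ∉ e.closedFar (7 / 4 * l q.1) → secP q = secG q) →
        ContMDiffOn (𝓘(ℝ, ℝ).prod (𝓡 3)) ((𝓡 3).prod 𝓘(ℝ, E3 →L[ℝ] E3 →L[ℝ] ℝ)) ∞
          (fun q : ℝ × X ↦ TotalSpace.mk' (E3 →L[ℝ] E3 →L[ℝ] ℝ)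
            (E := fun x : X ↦ TangentSpace (𝓡 3) x →L[ℝ] TangentSpace (𝓡 3) x →L[ℝ] ℝ) q.2 (secP q))
          {p : ℝ × X | Rstar < p.1} := by
      intro secP secG fld hGsec hfld hfar hin q hq
      obtain ⟨R, x⟩ := q
      have hR : Rstar < R := hq
      apply ContMDiffAt.contMDiffWithinAt
      -- a neighbourhood of `R` on which `l` moves by less than `l R / 8`
      have hl8 : 0 < l R / 8 := by linarith [hlpos hR]
      obtain ⟨δ, hδ, hδl⟩ := Metric.continuousAt_iff.1 hlcont.continuousAt (l R / 8) hl8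
      set N : Set ℝ := ball R δ ∩ Ioi Rstar with hN
      have hNopen : IsOpen N := isOpen_ball.inter isOpen_Ioi
      have hRN : R ∈ N := ⟨mem_ball_self hδ, hR⟩
      have hNl : ∀ R' ∈ N, |l R' - l R| < l R / 8 := fun R' hR' ↦ by
        have h := hδl hR'.1
        rwa [Real.dist_eq] at h
      set ρ' : ℝ := 3 / 2 * l R with hρ'
      by_cases hx : x ∈ e.closedFar ρ'
      · -- far out: `P = ` the outer family on `N × far (45/32 · l R)`
        obtain ⟨hxU, hxρ⟩ := hx
        have hxfar : x ∈ e.far (45 / 32 * l R) :=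
          e.mem_far_iff_coord.2 ⟨hxU, by linarith [hlpos hR]⟩
        -- the outer family is smooth at `(R, x)`
        have hc : ContMDiffAt (𝓘(ℝ, ℝ).prod 𝓘(ℝ, E3)) 𝓘(ℝ, E3 →L[ℝ] E3 →L[ℝ] ℝ) ∞
            (uncurry fun (R' : ℝ) (z : E3) ↦ fld (Cfam (l R')) z) (R, e.coord x) := by
          have h1 : ContMDiffAt (𝓘(ℝ, ℝ).prod 𝓘(ℝ, E3)) 𝓘(ℝ, E3 →L[ℝ] E3 →L[ℝ] ℝ) ∞
              (fun p : ℝ × E3 ↦ fld (Cfam p.1) p.2) (l R, e.coord x) :=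
            (hfld _ (hlpos hR)).contMDiffAt (hopenE.mem_nhds (hlpos hR))
          have h2 : ContMDiffAt (𝓘(ℝ, ℝ).prod 𝓘(ℝ, E3)) (𝓘(ℝ, ℝ).prod 𝓘(ℝ, E3)) ∞
              (fun p : ℝ × E3 ↦ (l p.1, p.2)) (R, e.coord x) :=
            ((hm.div_const μ).contMDiff.contMDiffAt.comp _ contMDiffAt_fst).prodMk contMDiffAt_snd
          exact h1.comp (R, e.coord x) h2
        have hsm := e.contMDiffAt_outerField_family (IP := 𝓘(ℝ, ℝ)) (c := fun (R' : ℝ) (z : E3) ↦ fld (Cfam (l R')) z)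
          hxU hc
        refine hsm.congr_of_eventuallyEq ?_
        have hev : ∀ᶠ q : ℝ × X in 𝓝 (R, x), q.1 ∈ N ∧ q.2 ∈ e.far (45 / 32 * l R) :=
          prod_mem_nhds (hNopen.mem_nhds hRN) ((e.isOpen_far _).mem_nhds hxfar)
        filter_upwards [hev] with q hq
        have hq1 : Rstar < q.1 := hq.1.2
        have hql := abs_lt.1 (hNl q.1 hq.1)
        have hq2 : q.2 ∈ e.far (5 / 4 * l q.1) := by
          refine e.far_mono ?_ hq.2
          linarith
        rw [hfar q hq1 hq2]
      · -- inside: `P = G` on `N × (closedFar ρ')ᶜ`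
        have hρ'R : e.R < ρ' := by
          have := hl32 hR; have := hRpos hR; rw [hρ']; linarith [heR, e.R_pos]
        have hGat : ContMDiffAt (𝓘(ℝ, ℝ).prod (𝓡 3)) ((𝓡 3).prod 𝓘(ℝ, E3 →L[ℝ] E3 →L[ℝ] ℝ)) ∞
            (fun q : ℝ × X ↦ TotalSpace.mk' (E3 →L[ℝ] E3 →L[ℝ] ℝ)
              (E := fun x : X ↦ TangentSpace (𝓡 3) x →L[ℝ] TangentSpace (𝓡 3) x →L[ℝ] ℝ) q.2 (secG q)) (R, x) :=
          (hGsec _ hR).contMDiffAt (hopen.mem_nhds hR)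
        refine hGat.congr_of_eventuallyEq ?_
        have hev : ∀ᶠ q : ℝ × X in 𝓝 (R, x), q.1 ∈ N ∧ q.2 ∉ e.closedFar ρ' :=
          prod_mem_nhds (hNopen.mem_nhds hRN) ((e.isClosed_closedFar hρ'R).isOpen_compl.mem_nhds hx)
        filter_upwards [hev] with q hq
        have hq1 : Rstar < q.1 := hq.1.2
        have hql := abs_lt.1 (hNl q.1 hq.1)
        have hq2 : q.2 ∉ e.closedFar (7 / 4 * l q.1) := by
          intro hmem
          obtain ⟨hU, hle⟩ := hmem
          exact hq.2 ⟨hU, by linarith⟩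
        rw [hin q hq1 hq2]
    refine ⟨key (fun q ↦ (P q.1).h.inner q.2) (fun q ↦ (G q.1).h.inner q.2) InitialDataSet.coordH hGs.1 hCh
        (fun q h hx ↦ (hPfar h hx).1) (fun q h hx ↦ (hPin h hx).1),
      key (fun q ↦ (P q.1).k q.2) (fun q ↦ (G q.1).k q.2) InitialDataSet.coordK hGs.2 hCk
        (fun q h hx ↦ (hPfar h hx).2) (fun q h hx ↦ (hPin h hx).2)⟩
  · -- admissibility: vacuum outside the ball of radius `l R` suffices; the end of the bag
    rw [hP hR]
    obtain ⟨hGadm, -, -⟩ := hG R hR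
    have hGvac : ∀ [(G R).metric.HasLeviCivita], (G R).IsVacuumConstraintSolution := fun {inst} ↦ (hGadm.1).1
    obtain ⟨hCvac, -, hiso⟩ := hC (l R) (hlpos hR)
    obtain ⟨f, hfsole, hfdecay⟩ := exists_end_of_isIsotropicBeyond (mul_pos (hlpos hR) hM0).le
      (div_pos (mul_pos (hlpos hR) hM0) two_pos) hiso
    exact annulusPatch_mem_admissibleVacuumData_of_vacuumOn (hA hR) he hGvac hCvac hfsole hfdecay
  · -- the sheet shield, read through the chart of the end (`lM/2 > 2l > 5l/4`)
    have h54 : e.R ≤ 5 / 4 * l R := by linarith [hl32 hR, hRpos hR, heR]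
    have hρ : 5 / 4 * l R ≤ l R * M / 2 := by nlinarith [hlpos hR]
    exact isSheetShielded_of_far_pullback e he (P R) (Cfam (l R)) h54 hρ (mul_pos (hlpos hR) hM0)
      (fun x hx ↦ (hPfar hR hx).1) (fun x hx ↦ (hPfar hR hx).2) (hC (l R) (hlpos hR)).2.2
  · -- agreement with `G R` off `e.far (32 R)`
    have hx' : x ∉ e.far (5 / 4 * l R) := fun h ↦ hx (e.far_mono (by linarith [hl32 hR, hRpos hR]) h)
    rw [hP hR]
    exact AFEnd.annulusPatch_eq_of_not_mem_far (hA hR) hx'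

end Summit.FinalStateConjecture.FinalStateConjecture.Theorems.SwallowTheDatum.UniversalWitnessFamily

end
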